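import Mathlib
import Literature.Analysis.FluidPDE.HarmonicLiouvilleSublinear
import Literature.Analysis.FluidPDE.HomogeneousEulerProofs
import Literature.Analysis.FluidPDE.SelfSimilarEulerProfile
import HarnessLib.Audit

/-!
# Rung C1 of the crux `EulerZoomLiouville.PowerGaugeEulerLiouville`, NO-DRIFT lane (3f): the Liouville endgame WITHOUT
# the far-field bounds — a bounded irrotational self-similar profile with pressure bounded above vanishes

Route №10 `EulerZoomLiouville` (NavierStokesRegularity), crux E = stmt-NavierStokesRegularity-19832, tenure rung C1.
Lineage ns-typeII-p2 (gen 7).  Companion of `…SelfSimilarNoDriftBounded` (3e): together they remove CIV's far field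
(3.8) from the classical C1 endgame, leaving the `Kelvin` hypotheses (`V` smooth bounded, `DV` bounded, `P ≤ P₀`,
`0 < γ < ½`).  The last step of the exclusion (after «every bad node has a null backward basin» ⇒ `curl V ≡ 0`) was
`eq_of_curl_eq_zero_of_isDivFree_of_fderiv_tendsto_zero` (needs `DV → 0` at infinity) plus `V(0) = 0`; here instead:

* `eq_const_of_curl_eq_zero_of_bounded` — a bounded `C²` field with `curl V = 0`, `div V = 0` is constant (its
  components are bounded harmonic functions: the tree's sublinear Liouville `HarmonicOnNhd.apply_eq_apply_of_sublinear`);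
* **`eq_zero_of_curl_eq_zero_of_bounded`** — if moreover `(V, P)` solves the profile equation (3.3) with `γ ≠ 1` and
  `P` is bounded above, then `V ≡ 0`: a constant profile `a` has `∇P ≡ −(1−γ)a`, so `P(−ta) = P(0) + (1−γ)|a|²t` is
  unbounded above unless `a = 0`.

WHAT THIS IS NOT: not NS, not E, not rung C1. [cite: ChaeShvydkoy2013, §4 Thm 4.1 (proof, last paragraph: Liouville for
the irrotational profile); GilbargTrudinger2001 Thm 2.1]
-/

noncomputable section

-- flat `Theorems/<Route><Decl>…` files of one crux share the namespace of the crux (tree convention)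
set_option linter.dupNamespace false

open MeasureTheory Set Filter Topology Metric Function InnerProductSpace
open scoped RealInnerProductSpace Laplacian

namespace Summit.NavierStokesRegularity.NavierStokesRegularity.Theorems.PowerGaugeEulerLiouville.NoDrift

open Literature.Analysis Literature.Analysis.FluidPDE

/-- **A bounded irrotational incompressible `C²` field on `ℝ³` is constant** (components are bounded harmonic
functions). [cite: GilbargTrudinger2001, Thm 2.1 (Liouville via mean values)] -/
theorem eq_const_of_curl_eq_zero_of_bounded {V : EuclideanSpace ℝ (Fin 3) → EuclideanSpace ℝ (Fin 3)}
    (hV : ContDiff ℝ 2 V) (hcurl : ∀ x, curl V x = 0) (hdiv : VectorCalculus.IsDivFree V) {M : ℝ}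
    (hM : ∀ y, ‖V y‖ ≤ M) (x y : EuclideanSpace ℝ (Fin 3)) : V x = V y := by
  have hΔ := laplacian_eq_zero_of_curl_eq_zero_of_isDivFree hV hcurl hdiv
  have hM0 : 0 ≤ M := (norm_nonneg _).trans (hM 0)
  -- sublinear growth from boundedness
  have hgrowth : ∀ δ : ℝ, 0 < δ → ∃ Rδ : ℝ, ∀ z : EuclideanSpace ℝ (Fin 3), Rδ ≤ ‖z‖ → ‖V z‖ ≤ δ * ‖z‖ := by
    intro δ hδ
    refine ⟨M / δ, fun z hz => (hM z).trans ?_⟩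
    rwa [div_le_iff₀ hδ, mul_comm] at hz
  ext i
  set η : EuclideanSpace ℝ (Fin 3) → ℝ := fun z => V z i with hη
  have hηeq : η = (EuclideanSpace.proj i : EuclideanSpace ℝ (Fin 3) →L[ℝ] ℝ) ∘ V := by funext z; rfl
  have hη2 : ContDiff ℝ 2 η := by
    rw [hηeq]; exact (EuclideanSpace.proj i : EuclideanSpace ℝ (Fin 3) →L[ℝ] ℝ).contDiff.comp hV
  have hηΔ : ∀ z, (Δ η) z = 0 := fun z => by
    rw [hηeq, hV.contDiffAt.laplacian_CLM_comp_left, Function.comp_apply, hΔ z, map_zero]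
  have hharm : HarmonicOnNhd η univ := harmonicOnNhd_of_laplacian_eq_zero hη2 hηΔ
  have hgr : ∀ δ : ℝ, 0 < δ → ∃ Rδ : ℝ, ∀ z : EuclideanSpace ℝ (Fin 3), Rδ ≤ ‖z‖ → |η z| ≤ δ * ‖z‖ := by
    intro δ hδ
    obtain ⟨Rδ, hRδ⟩ := hgrowth δ hδ
    refine ⟨Rδ, fun z hz => le_trans ?_ (hRδ z hz)⟩
    simpa [hη, Real.norm_eq_abs] using PiLp.norm_apply_le (V z) i
  exact hharm.apply_eq_apply_of_sublinear hgr x y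

/-- **A bounded irrotational self-similar Euler profile with pressure bounded above is trivial** (`γ ≠ 1`): by the
previous lemma `V ≡ a` is constant; the profile equation (3.3) then reads `∇P ≡ −(1−γ)a`, so along the ray `−ta` the
pressure grows linearly with slope `(1−γ)|a|²`, contradicting `P ≤ P₀` unless `a = 0`.
[cite: ChaeShvydkoy2013, §4 Thm 4.1 (proof, last paragraph)] -/
theorem eq_zero_of_curl_eq_zero_of_bounded {γ : ℝ} {V : EuclideanSpace ℝ (Fin 3) → EuclideanSpace ℝ (Fin 3)}
    {P : EuclideanSpace ℝ (Fin 3) → ℝ} (hprof : IsSelfSimilarEulerProfile γ 0 V P) (hγ : γ ≠ 1) {M P₀ : ℝ}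
    (hM : ∀ y, ‖V y‖ ≤ M) (hP : ∀ y, P y ≤ P₀) (hcurl : ∀ x, curl V x = 0) : V = 0 := by
  have hV2 : ContDiff ℝ 2 V := hprof.contDiff_velocity
  have hconst := eq_const_of_curl_eq_zero_of_bounded hV2 hcurl hprof.divFree hM
  set a : EuclideanSpace ℝ (Fin 3) := V 0 with ha
  have hVa : V = fun _ => a := funext fun y => hconst y 0
  -- the gradient of the pressure is the constant `−(1−γ) a`
  have hgradP : ∀ y, gradient P y = -((1 - γ) • a) := by
    intro y
    have e := hprof.profile_eq y
    have hD : fderiv ℝ V y = 0 := by rw [hVa]; exact fderiv_const_apply a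
    rw [hD, hconst y 0] at e
    have e' : (1 - γ) • a + gradient P y = 0 := by simpa using e
    exact eq_neg_of_add_eq_zero_right e'
  -- the pressure along the ray `t ↦ P (−t a)`
  set φ : ℝ → ℝ := fun t => P ((-t) • a) with hφ
  have hPd := hprof.differentiable_pressure
  have hφ' : ∀ t, HasDerivAt φ ((1 - γ) * ‖a‖ ^ 2) t := by
    intro t
    have h1 : HasDerivAt (fun s : ℝ => (-s) • a) ((-1 : ℝ) • a) t := by
      simpa using ((hasDerivAt_neg t).smul_const a)
    have h2 := ((hPd ((-t) • a)).hasFDerivAt).comp_hasDerivAt t h1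
    refine h2.congr_deriv ?_
    rw [← inner_gradient_left, hgradP, inner_neg_left, inner_smul_left, inner_smul_right, real_inner_self_eq_norm_sq]
    simp
  -- so `φ t = φ 0 + (1−γ)|a|² t`
  have hlin : ∀ t, φ t = φ 0 + (1 - γ) * ‖a‖ ^ 2 * t := by
    have hψ : ∀ s, HasDerivAt (fun t => φ t - (1 - γ) * ‖a‖ ^ 2 * t) 0 s := by
      intro s
      have h := (hφ' s).sub ((hasDerivAt_id s).const_mul ((1 - γ) * ‖a‖ ^ 2))
      rw [mul_one, sub_self] at h
      exact h
    intro t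
    have hc := is_const_of_deriv_eq_zero (fun s => (hψ s).differentiableAt) (fun s => (hψ s).deriv) t 0
    simp only [mul_zero, sub_zero] at hc
    linarith
  -- unbounded above unless `a = 0`
  by_contra hne
  have ha0 : a ≠ 0 := by
    intro h0; apply hne; rw [hVa, h0]; rfl
  have hc : (1 - γ) * ‖a‖ ^ 2 ≠ 0 := mul_ne_zero (sub_ne_zero.2 (Ne.symm hγ)) (by positivity)
  set t₀ : ℝ := (P₀ - φ 0 + 1) / ((1 - γ) * ‖a‖ ^ 2) with ht₀
  have h1 : φ t₀ = P₀ + 1 := by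
    rw [hlin t₀, ht₀, mul_div_cancel₀ _ hc]; ring
  have h2 : φ t₀ ≤ P₀ := hP _
  linarith

end Summit.NavierStokesRegularity.NavierStokesRegularity.Theorems.PowerGaugeEulerLiouville.NoDrift

end
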